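import Summits.CriticalPhenomena.PercolationContinuityZ3.Theorems.PercNearOneGluingNearOneGluingS2OfS2M
import Literature.Probability.Percolation.TwoClusterConditionalAssociationProofs

/-!
# Crux `PercNearOneGluing.NearOneGluing` (stmt-CriticalPhenomena-4574), line `SketchR2I5` —
# the hole-resampling operator `T` and the telescoping identity (part I)

Lead prover-line-stmt-CriticalPhenomena-4574-c7 (cycle 7, wave 4, stub-worker W7).  Lands
`--supports stmt-CriticalPhenomena-4574`; no definitions, no named facts.

## Content

Finite weighted graph on `Fin n`, `μ = prodBernoulli w` (`weight` = its atom weights), `C_v(ω) = openEdgeCluster ω v`,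
`D := {y ↮ z}`, `D_a := {x↮y} ∩ {x↮z}`, `W := D_a ∩ {o↔x}`; `V̄(C)` = the pairs meeting `{v} ∪ V(C)` (BHK's `W̄` for the
source `v`).  Given `C_z = Z` on `D`, the configuration off `Z̄` is fresh (domain Markov property, BHK display (10),
`BHK2006.sum_cond_cluster`), so with the **hole average** `(A G)(Z) := Σ_η weight(η) G(C_y(η ∖ Z̄))` and the
**hole-resampling operator** `(T G)(C) := Σ_η weight(η) (A G)(C_z(η ∖ C̄))` (resample everything outside the closed
cluster of `z`, read off the new cluster of `y`; a reversible Markov operator on increasing functions of `C_y`):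

* `tel_identity`:  `S(G) − S(T G) = μ(D)·INNER(G)`, where `S(G) := μ(D)·E[φ G(C_y); D] − E[φ; D]·E[G(C_y); D]` is the
  S1-gen slack (`φ := μ(D_a)·1{o↔y} − μ(W)·1{x↔y}`, i.e. `S(G) = μ(D_a)μ(D)²·[Cov_D(1{o↔y},G) − θ Cov_D(1{x↔y},G)]`) and
  `INNER(G) := E[φ G(C_y); D] − E[(Aφ)(C_z)·(AG)(C_z); D]` is the hole-averaged UNCONDITIONED covariance
  `Σ_Z μ(C_z = Z; D)·Cov_{G−V(Z)}(φ, G)`;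
* `tel_monotone_T`: `T` maps increasing `G` to increasing `T G`;
* `tel_contract`: `(T G)(univ) − (T G)(∅) ≤ ρ·(G(univ) − G(∅))` with `ρ = 1 − weight(∅) < 1` when all weights are `< 1`
  (Doeblin: on the empty configuration the hole is empty whatever `C` is);
* `tel_S_iter`, `tel_S_lower`: `S` decreases along the iterates when every `INNER` is nonnegative, and
  `S(F) ≥ −2(F(univ) − F(∅))` for increasing `F`.
Part II (`…S1GenOfInnerHole`) concludes: `INNER ≥ 0` for all increasing `H` ⟹ S1-gen (all weights `< 1`).
[cite: VandenbergHaggstromKahn2005, §1 pp. 7–8, display (10)] [cite: KozmaNitzan2024, Question 7 (p. 36)]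
-/

namespace Summit.CriticalPhenomena.PercolationContinuityZ3.Theorems

open MeasureTheory Set Literature.Probability.LatticeModels Literature.Probability.Percolation
open Literature.Probability.Percolation.BHK2006
open scoped Classical
open Q7ThreeCut
open DecisionTree (ind ind_of_mem ind_of_not_mem ind_nonneg)

noncomputable section

variable {n : ℕ}

/-- `wt⟦w⟧ η`: the atom weight of the configuration `η` under `prodBernoulli w` (file-local notation for the tree term). -/
local notation3 (prettyPrint := false) "wt⟦" w "⟧" => weight (fun e => ((w : Sym2 (Fin _) → unitInterval) e : ℝ))

/-- `bar⟦v, C⟧`: BHK's `C̄` for the source `v` — the pairs meeting `{v} ∪ V(C)` (file-local notation for the tree term). -/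
local notation3 (prettyPrint := false) "bar⟦" v ", " C "⟧" => {e : Sym2 (Fin _) | ∃ u ∈ e, u = v ∨ ∃ e' ∈ (C : Set (Sym2 (Fin _))), u ∈ e'}

/-- `hole⟦w, y, z, G⟧ Z`: the hole average `(A G)(Z) = Σ_η weight(η)·G(C_y(η ∖ Z̄))` (file-local notation). -/
local notation3 (prettyPrint := false) "hole⟦" w ", " y ", " z ", " G "⟧" =>
  fun Z : Set (Sym2 (Fin _)) => ∑ η : Set (Sym2 (Fin _)), wt⟦w⟧ η * (G : Set (Sym2 (Fin _)) → ℝ) (openEdgeCluster (η \ bar⟦z, Z⟧) y)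

/-- `resam⟦w, y, z, G⟧ C`: the hole-resampling operator `(T G)(C) = Σ_η weight(η)·(A G)(C_z(η ∖ C̄))` (file-local notation). -/
local notation3 (prettyPrint := false) "resam⟦" w ", " y ", " z ", " G "⟧" =>
  fun C : Set (Sym2 (Fin _)) => ∑ η : Set (Sym2 (Fin _)), wt⟦w⟧ η * (hole⟦w, y, z, G⟧) (openEdgeCluster (η \ bar⟦y, C⟧) z)

/-! ### Weights -/

/-- Total mass one. [folklore] -/
theorem tel_sum_weight (w : Sym2 (Fin n) → unitInterval) : ∑ ω, wt⟦w⟧ ω = 1 := by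
  have h1 := integral_prodBernoulli_eq_sum w fun _ => (1 : ℝ)
  simp only [integral_const, probReal_univ, smul_eq_mul, mul_one] at h1
  exact h1.symm

/-- Nonnegative weights. [folklore] -/
theorem tel_weight_nonneg (w : Sym2 (Fin n) → unitInterval) (ω : Set (Sym2 (Fin n))) : 0 ≤ wt⟦w⟧ ω :=
  weight_nonneg (fun e => (w e).2.1) (fun e => (w e).2.2) ω

/-- A weighted average lies below the maximum of the averaged values. [folklore] -/
theorem tel_avg_le (w : Sym2 (Fin n) → unitInterval) (f : Set (Sym2 (Fin n)) → ℝ) (M : ℝ) (hf : ∀ η, f η ≤ M) :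
    ∑ η, wt⟦w⟧ η * f η ≤ M := by
  calc ∑ η, wt⟦w⟧ η * f η ≤ ∑ η, wt⟦w⟧ η * M :=
        Finset.sum_le_sum fun η _ => mul_le_mul_of_nonneg_left (hf η) (tel_weight_nonneg w η)
    _ = M := by rw [← Finset.sum_mul, tel_sum_weight, one_mul]

/-- A weighted average lies above the minimum of the averaged values. [folklore] -/
theorem tel_le_avg (w : Sym2 (Fin n) → unitInterval) (f : Set (Sym2 (Fin n)) → ℝ) (m : ℝ) (hf : ∀ η, m ≤ f η) :
    m ≤ ∑ η, wt⟦w⟧ η * f η := by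
  calc m = ∑ η, wt⟦w⟧ η * m := by rw [← Finset.sum_mul, tel_sum_weight, one_mul]
    _ ≤ ∑ η, wt⟦w⟧ η * f η := Finset.sum_le_sum fun η _ => mul_le_mul_of_nonneg_left (hf η) (tel_weight_nonneg w η)

/-! ### The two Markov identities (BHK display (10) for the sources `z` and `y`) -/

/-- **Markov property for the cluster of `z`** (`BHK2006.sum_cond_cluster`, `s = z`, `t = y`): for `H(C_z, C_y)`,
`E[H(C_z, C_y); y↮z] = E[(Σ_η weight(η) H(C_z, C_y(η ∖ C̄_z))); y↮z]`.
[cite: VandenbergHaggstromKahn2005, §1 pp. 7–8, display (10)] -/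
theorem tel_markov_z (w : Sym2 (Fin n) → unitInterval) (y z : Fin n)
    (H : Set (Sym2 (Fin n)) → Set (Sym2 (Fin n)) → ℝ) :
    ∑ ω, wt⟦w⟧ ω * (H (openEdgeCluster ω z) (openEdgeCluster ω y) * ind ((openConn y z)ᶜ) ω) =
      ∑ ω, wt⟦w⟧ ω * ((∑ η, wt⟦w⟧ η * H (openEdgeCluster ω z)
        (openEdgeCluster (η \ bar⟦z, openEdgeCluster ω z⟧) y)) * ind ((openConn y z)ᶜ) ω) := by
  have hD : ∀ ω : Set (Sym2 (Fin n)), ω ∈ ((openConn y z)ᶜ : Set (BondConfig (Fin n))) ↔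
      ¬ (openGraph ω).Reachable z y := fun ω =>
    ⟨fun h hr => h (show ω ∈ (openConn y z : Set (BondConfig (Fin n))) from hr.symm),
     fun h hr => h (SimpleGraph.Reachable.symm hr)⟩
  exact sum_cond_cluster (fun e => (w e : ℝ)) (tel_sum_weight w) z y H hD

/-- **Markov property for the cluster of `y`** (`BHK2006.sum_cond_cluster`, `s = y`, `t = z`): for `H(C_y, C_z)`,
`E[H(C_y, C_z); y↮z] = E[(Σ_η weight(η) H(C_y, C_z(η ∖ C̄_y))); y↮z]`.
[cite: VandenbergHaggstromKahn2005, §1 pp. 7–8, display (10)] -/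
theorem tel_markov_y (w : Sym2 (Fin n) → unitInterval) (y z : Fin n)
    (H : Set (Sym2 (Fin n)) → Set (Sym2 (Fin n)) → ℝ) :
    ∑ ω, wt⟦w⟧ ω * (H (openEdgeCluster ω y) (openEdgeCluster ω z) * ind ((openConn y z)ᶜ) ω) =
      ∑ ω, wt⟦w⟧ ω * ((∑ η, wt⟦w⟧ η * H (openEdgeCluster ω y)
        (openEdgeCluster (η \ bar⟦y, openEdgeCluster ω y⟧) z)) * ind ((openConn y z)ᶜ) ω) := by
  have hD : ∀ ω : Set (Sym2 (Fin n)), ω ∈ ((openConn y z)ᶜ : Set (BondConfig (Fin n))) ↔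
      ¬ (openGraph ω).Reachable y z := fun ω => Iff.rfl
  exact sum_cond_cluster (fun e => (w e : ℝ)) (tel_sum_weight w) y z H hD

/-! ### The telescoping identity `S(G) − S(T G) = μ(D)·INNER(G)` -/

/-- **`T` preserves the `D`-mean**: `E[(T G)(C_y); D] = E[G(C_y); D]` (both equal `E[(A G)(C_z); D]`). [folklore] -/
theorem tel_mean_T (w : Sym2 (Fin n) → unitInterval) (y z : Fin n) (G : Set (Sym2 (Fin n)) → ℝ) :
    ∑ ω, wt⟦w⟧ ω * ((resam⟦w, y, z, G⟧) (openEdgeCluster ω y) * ind ((openConn y z)ᶜ) ω) =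
      ∑ ω, wt⟦w⟧ ω * (G (openEdgeCluster ω y) * ind ((openConn y z)ᶜ) ω) := by
  -- both sides equal `E[(A G)(C_z); D]`
  have h1 := tel_markov_y w y z (fun _ Cz => (hole⟦w, y, z, G⟧) Cz)
  have h2 := tel_markov_z w y z (fun _ Cy => G Cy)
  simp only at h1 h2
  rw [h2]
  exact h1.symm

/-- **`E[φ·(T G); D] = E[(Aφ)(C_z)·(A G)(C_z); D]`** for any `φ` read off `C_y`. [folklore] -/
theorem tel_cross_T (w : Sym2 (Fin n) → unitInterval) (y z : Fin n) (φ G : Set (Sym2 (Fin n)) → ℝ) :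
    ∑ ω, wt⟦w⟧ ω * (φ (openEdgeCluster ω y) * (resam⟦w, y, z, G⟧) (openEdgeCluster ω y) * ind ((openConn y z)ᶜ) ω) =
      ∑ ω, wt⟦w⟧ ω * ((hole⟦w, y, z, φ⟧) (openEdgeCluster ω z) * (hole⟦w, y, z, G⟧) (openEdgeCluster ω z) *
        ind ((openConn y z)ᶜ) ω) := by
  -- `E[φ(C_y) u(C_z); D]` computed in two ways, `u = A G`
  have h1 := tel_markov_y w y z (fun Cy Cz => φ Cy * (hole⟦w, y, z, G⟧) Cz)
  have h2 := tel_markov_z w y z (fun Cz Cy => φ Cy * (hole⟦w, y, z, G⟧) Cz)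
  simp only at h1 h2
  have e1 : ∀ ω : Set (Sym2 (Fin n)),
      wt⟦w⟧ ω * ((∑ η, wt⟦w⟧ η * (φ (openEdgeCluster ω y) *
        (hole⟦w, y, z, G⟧) (openEdgeCluster (η \ bar⟦y, openEdgeCluster ω y⟧) z))) * ind ((openConn y z)ᶜ) ω) =
      wt⟦w⟧ ω * (φ (openEdgeCluster ω y) * (resam⟦w, y, z, G⟧) (openEdgeCluster ω y) * ind ((openConn y z)ᶜ) ω) := by
    intro ω
    simp only
    rw [Finset.mul_sum]
    congr 1
    rw [Finset.sum_mul, Finset.sum_mul]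
    exact Finset.sum_congr rfl fun η _ => by ring
  have e2 : ∀ ω : Set (Sym2 (Fin n)),
      wt⟦w⟧ ω * ((∑ η, wt⟦w⟧ η * (φ (openEdgeCluster (η \ bar⟦z, openEdgeCluster ω z⟧) y) *
        (hole⟦w, y, z, G⟧) (openEdgeCluster ω z))) * ind ((openConn y z)ᶜ) ω) =
      wt⟦w⟧ ω * ((hole⟦w, y, z, φ⟧) (openEdgeCluster ω z) * (hole⟦w, y, z, G⟧) (openEdgeCluster ω z) *
        ind ((openConn y z)ᶜ) ω) := by
    intro ω
    simp only [Finset.sum_mul, mul_assoc]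
  calc _ = ∑ ω, wt⟦w⟧ ω * ((∑ η, wt⟦w⟧ η * (φ (openEdgeCluster ω y) *
          (hole⟦w, y, z, G⟧) (openEdgeCluster (η \ bar⟦y, openEdgeCluster ω y⟧) z))) * ind ((openConn y z)ᶜ) ω) :=
        (Finset.sum_congr rfl fun ω _ => e1 ω).symm
    _ = ∑ ω, wt⟦w⟧ ω * (φ (openEdgeCluster ω y) * (hole⟦w, y, z, G⟧) (openEdgeCluster ω z) *
          ind ((openConn y z)ᶜ) ω) := h1.symm
    _ = _ := h2
    _ = _ := Finset.sum_congr rfl fun ω _ => e2 ω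

/-- **The telescoping identity** `S(G) − S(T G) = μ(D)·INNER(G)` for any `φ` read off `C_y`, with
`S(G) = μ(D)·E[φG; D] − E[φ; D]E[G; D]` and `INNER(G) = E[φG; D] − E[(Aφ)(C_z)(AG)(C_z); D]`. [folklore] -/
theorem tel_identity (w : Sym2 (Fin n) → unitInterval) (y z : Fin n) (φ G : Set (Sym2 (Fin n)) → ℝ) :
    ((∑ ω, wt⟦w⟧ ω * ind ((openConn y z)ᶜ) ω) *
          (∑ ω, wt⟦w⟧ ω * (φ (openEdgeCluster ω y) * G (openEdgeCluster ω y) * ind ((openConn y z)ᶜ) ω)) -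
        (∑ ω, wt⟦w⟧ ω * (φ (openEdgeCluster ω y) * ind ((openConn y z)ᶜ) ω)) *
          (∑ ω, wt⟦w⟧ ω * (G (openEdgeCluster ω y) * ind ((openConn y z)ᶜ) ω))) -
      ((∑ ω, wt⟦w⟧ ω * ind ((openConn y z)ᶜ) ω) *
          (∑ ω, wt⟦w⟧ ω * (φ (openEdgeCluster ω y) * (resam⟦w, y, z, G⟧) (openEdgeCluster ω y) *
            ind ((openConn y z)ᶜ) ω)) -
        (∑ ω, wt⟦w⟧ ω * (φ (openEdgeCluster ω y) * ind ((openConn y z)ᶜ) ω)) *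
          (∑ ω, wt⟦w⟧ ω * ((resam⟦w, y, z, G⟧) (openEdgeCluster ω y) * ind ((openConn y z)ᶜ) ω))) =
    (∑ ω, wt⟦w⟧ ω * ind ((openConn y z)ᶜ) ω) *
      ((∑ ω, wt⟦w⟧ ω * (φ (openEdgeCluster ω y) * G (openEdgeCluster ω y) * ind ((openConn y z)ᶜ) ω)) -
        ∑ ω, wt⟦w⟧ ω * ((hole⟦w, y, z, φ⟧) (openEdgeCluster ω z) * (hole⟦w, y, z, G⟧) (openEdgeCluster ω z) *
          ind ((openConn y z)ᶜ) ω)) := by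
  rw [tel_cross_T, tel_mean_T]
  ring

/-! ### Monotonicity of the hole average and of `T` -/

/-- The hole average of an increasing `G` is decreasing in the hole. [folklore] -/
theorem tel_antitone_hole (w : Sym2 (Fin n) → unitInterval) (y z : Fin n) (G : Set (Sym2 (Fin n)) → ℝ)
    (hG : Monotone G) : Antitone (hole⟦w, y, z, G⟧) := by
  intro Z Z' hZZ'
  refine Finset.sum_le_sum fun η _ => mul_le_mul_of_nonneg_left (hG ?_) (tel_weight_nonneg w η)
  exact openEdgeCluster_mono (Set.sdiff_subset_sdiff_right (bar_mono z hZZ')) y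

/-- Values of the hole average of an increasing `G` lie in `[G ∅, G univ]`. [folklore] -/
theorem tel_hole_bounds (w : Sym2 (Fin n) → unitInterval) (y z : Fin n) (G : Set (Sym2 (Fin n)) → ℝ)
    (hG : Monotone G) (Z : Set (Sym2 (Fin n))) :
    G ∅ ≤ (hole⟦w, y, z, G⟧) Z ∧ (hole⟦w, y, z, G⟧) Z ≤ G univ :=
  ⟨tel_le_avg w _ _ fun _ => hG (empty_subset _), tel_avg_le w _ _ fun _ => hG (subset_univ _)⟩

/-- **`T` maps increasing functions to increasing functions.** [folklore] -/
theorem tel_monotone_T (w : Sym2 (Fin n) → unitInterval) (y z : Fin n) (G : Set (Sym2 (Fin n)) → ℝ)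
    (hG : Monotone G) : Monotone (resam⟦w, y, z, G⟧) := by
  intro C C' hCC'
  refine Finset.sum_le_sum fun η _ => mul_le_mul_of_nonneg_left ?_ (tel_weight_nonneg w η)
  exact tel_antitone_hole w y z G hG
    (openEdgeCluster_mono (Set.sdiff_subset_sdiff_right (bar_mono y hCC')) z)

/-- Values of `T G` lie in `[G ∅, G univ]` for increasing `G`. [folklore] -/
theorem tel_T_bounds (w : Sym2 (Fin n) → unitInterval) (y z : Fin n) (G : Set (Sym2 (Fin n)) → ℝ)
    (hG : Monotone G) (C : Set (Sym2 (Fin n))) :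
    G ∅ ≤ (resam⟦w, y, z, G⟧) C ∧ (resam⟦w, y, z, G⟧) C ≤ G univ :=
  ⟨tel_le_avg w _ _ fun _ => (tel_hole_bounds w y z G hG _).1,
   tel_avg_le w _ _ fun _ => (tel_hole_bounds w y z G hG _).2⟩

/-! ### The Doeblin contraction -/

/-- The open cluster of the empty configuration is empty. [folklore] -/
theorem tel_cluster_empty_config (B : Set (Sym2 (Fin n))) (v : Fin n) :
    openEdgeCluster ((∅ : Set (Sym2 (Fin n))) \ B) v = ∅ :=
  Set.eq_empty_of_subset_empty fun _ he => (Set.empty_sdiff (s := B)).subset (openEdgeCluster_subset _ v he)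

/-- **Doeblin contraction**: `(T G)(univ) − (T G)(∅) ≤ (1 − weight(∅))·(G(univ) − G(∅))` for increasing `G` — on the
empty configuration the hole is empty whatever `C` is. [folklore] -/
theorem tel_contract (w : Sym2 (Fin n) → unitInterval) (y z : Fin n) (G : Set (Sym2 (Fin n)) → ℝ)
    (hG : Monotone G) :
    (resam⟦w, y, z, G⟧) univ - (resam⟦w, y, z, G⟧) ∅ ≤ (1 - wt⟦w⟧ ∅) * (G univ - G ∅) := by
  set u : Set (Sym2 (Fin n)) → ℝ := hole⟦w, y, z, G⟧ with hu
  set R : ℝ := G univ - G ∅ with hR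
  have hR0 : 0 ≤ R := sub_nonneg.2 (hG (empty_subset _))
  -- termwise bound, the empty configuration contributing zero
  have hterm : ∀ η : Set (Sym2 (Fin n)),
      wt⟦w⟧ η * u (openEdgeCluster (η \ bar⟦y, (univ : Set (Sym2 (Fin n)))⟧) z) -
          wt⟦w⟧ η * u (openEdgeCluster (η \ bar⟦y, (∅ : Set (Sym2 (Fin n)))⟧) z) ≤
        wt⟦w⟧ η * R - (if η = ∅ then wt⟦w⟧ ∅ * R else 0) := by
    intro η
    by_cases hη : η = ∅
    · subst hη
      rw [if_pos rfl, tel_cluster_empty_config, tel_cluster_empty_config, sub_self, sub_self]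
    · rw [if_neg hη, sub_zero, ← mul_sub]
      refine mul_le_mul_of_nonneg_left ?_ (tel_weight_nonneg w η)
      have h1 := (tel_hole_bounds w y z G hG (openEdgeCluster (η \ bar⟦y, (univ : Set (Sym2 (Fin n)))⟧) z)).2
      have h2 := (tel_hole_bounds w y z G hG (openEdgeCluster (η \ bar⟦y, (∅ : Set (Sym2 (Fin n)))⟧) z)).1
      simp only [hu, hR]; linarith
  have hsum := Finset.sum_le_sum fun η (_ : η ∈ Finset.univ) => hterm η
  rw [Finset.sum_sub_distrib, Finset.sum_sub_distrib, Finset.sum_ite_eq' Finset.univ (∅ : Set (Sym2 (Fin n))),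
    if_pos (Finset.mem_univ _), ← Finset.sum_mul, tel_sum_weight] at hsum
  simp only [hu] at hsum ⊢
  linarith

/-! ### Iterating `T` -/

/-- Iterates of `T` of an increasing function are increasing. [folklore] -/
theorem tel_monotone_iter (w : Sym2 (Fin n) → unitInterval) (y z : Fin n) (K : ℕ) :
    ∀ G : Set (Sym2 (Fin n)) → ℝ, Monotone G →
      Monotone ((fun G : Set (Sym2 (Fin n)) → ℝ => resam⟦w, y, z, G⟧)^[K] G) := by
  induction K with
  | zero => intro G hG; simpa using hG
  | succ K ih =>
    intro G hG
    rw [Function.iterate_succ_apply]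
    exact ih _ (tel_monotone_T w y z G hG)

/-- The oscillation of the iterates contracts geometrically: `(T^K G)(univ) − (T^K G)(∅) ≤ ρ^K·(G(univ) − G(∅))`,
`ρ = 1 − weight(∅)`. [folklore] -/
theorem tel_contract_iter (w : Sym2 (Fin n) → unitInterval) (y z : Fin n) (K : ℕ) :
    ∀ G : Set (Sym2 (Fin n)) → ℝ, Monotone G →
      ((fun G : Set (Sym2 (Fin n)) → ℝ => resam⟦w, y, z, G⟧)^[K] G) univ -
          ((fun G : Set (Sym2 (Fin n)) → ℝ => resam⟦w, y, z, G⟧)^[K] G) ∅ ≤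
        (1 - wt⟦w⟧ ∅) ^ K * (G univ - G ∅) := by
  induction K with
  | zero => intro G _; simp
  | succ K ih =>
    intro G hG
    rw [Function.iterate_succ_apply, pow_succ]
    have h1 := ih _ (tel_monotone_T w y z G hG)
    have h2 := tel_contract w y z G hG
    have hρ : 0 ≤ (1 - wt⟦w⟧ (∅ : Set (Sym2 (Fin n)))) ^ K := by
      refine pow_nonneg (sub_nonneg.2 ?_) K
      simpa [tel_sum_weight w] using
        Finset.single_le_sum (fun η (_ : η ∈ Finset.univ) => tel_weight_nonneg w η) (Finset.mem_univ ∅)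
    calc _ ≤ (1 - wt⟦w⟧ ∅) ^ K * ((resam⟦w, y, z, G⟧) univ - (resam⟦w, y, z, G⟧) ∅) := h1
      _ ≤ (1 - wt⟦w⟧ ∅) ^ K * ((1 - wt⟦w⟧ ∅) * (G univ - G ∅)) := mul_le_mul_of_nonneg_left h2 hρ
      _ = _ := by ring

/-- Along the iterates, `S` can only decrease when every `INNER` is nonnegative:
`S(G) − S(T^K G) = μ(D)·Σ_{k<K} INNER(T^k G) ≥ 0`. [folklore] -/
theorem tel_S_iter (w : Sym2 (Fin n) → unitInterval) (y z : Fin n) (φ : Set (Sym2 (Fin n)) → ℝ)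
    (hInner : ∀ H : Set (Sym2 (Fin n)) → ℝ, Monotone H →
      0 ≤ (∑ ω, wt⟦w⟧ ω * (φ (openEdgeCluster ω y) * H (openEdgeCluster ω y) * ind ((openConn y z)ᶜ) ω)) -
        ∑ ω, wt⟦w⟧ ω * ((hole⟦w, y, z, φ⟧) (openEdgeCluster ω z) * (hole⟦w, y, z, H⟧) (openEdgeCluster ω z) *
          ind ((openConn y z)ᶜ) ω))
    (K : ℕ) : ∀ G : Set (Sym2 (Fin n)) → ℝ, Monotone G →
      (∑ ω, wt⟦w⟧ ω * ind ((openConn y z)ᶜ) ω) *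
          (∑ ω, wt⟦w⟧ ω * (φ (openEdgeCluster ω y) *
            ((fun G : Set (Sym2 (Fin n)) → ℝ => resam⟦w, y, z, G⟧)^[K] G) (openEdgeCluster ω y) *
              ind ((openConn y z)ᶜ) ω)) -
        (∑ ω, wt⟦w⟧ ω * (φ (openEdgeCluster ω y) * ind ((openConn y z)ᶜ) ω)) *
          (∑ ω, wt⟦w⟧ ω * (((fun G : Set (Sym2 (Fin n)) → ℝ => resam⟦w, y, z, G⟧)^[K] G) (openEdgeCluster ω y) *
            ind ((openConn y z)ᶜ) ω)) ≤
      (∑ ω, wt⟦w⟧ ω * ind ((openConn y z)ᶜ) ω) *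
          (∑ ω, wt⟦w⟧ ω * (φ (openEdgeCluster ω y) * G (openEdgeCluster ω y) * ind ((openConn y z)ᶜ) ω)) -
        (∑ ω, wt⟦w⟧ ω * (φ (openEdgeCluster ω y) * ind ((openConn y z)ᶜ) ω)) *
          (∑ ω, wt⟦w⟧ ω * (G (openEdgeCluster ω y) * ind ((openConn y z)ᶜ) ω)) := by
  induction K with
  | zero => intro G _; simp
  | succ K ih =>
    intro G hG
    have hmono := tel_monotone_iter w y z K G hG
    have hstep := tel_identity w y z φ (((fun G : Set (Sym2 (Fin n)) → ℝ => resam⟦w, y, z, G⟧)^[K] G))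
    have hin := hInner _ hmono
    have hd : 0 ≤ ∑ ω, wt⟦w⟧ ω * ind ((openConn y z)ᶜ : Set (BondConfig (Fin n))) ω :=
      Finset.sum_nonneg fun ω _ => mul_nonneg (tel_weight_nonneg w ω) (ind_nonneg _ _)
    have h1 := ih G hG
    rw [Function.iterate_succ_apply']
    nlinarith [mul_nonneg hd hin, hstep, h1]

/-- A crude bound: for `|φ| ≤ 1` and an increasing `F`, `S(F) ≥ −2·(F(univ) − F(∅))`. [folklore] -/
theorem tel_S_lower (w : Sym2 (Fin n) → unitInterval) (y z : Fin n) (φ F : Set (Sym2 (Fin n)) → ℝ)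
    (hφ : ∀ C, |φ C| ≤ 1) (hF : Monotone F) :
    -(2 * (F univ - F ∅)) ≤
      (∑ ω, wt⟦w⟧ ω * ind ((openConn y z)ᶜ) ω) *
          (∑ ω, wt⟦w⟧ ω * (φ (openEdgeCluster ω y) * F (openEdgeCluster ω y) * ind ((openConn y z)ᶜ) ω)) -
        (∑ ω, wt⟦w⟧ ω * (φ (openEdgeCluster ω y) * ind ((openConn y z)ᶜ) ω)) *
          (∑ ω, wt⟦w⟧ ω * (F (openEdgeCluster ω y) * ind ((openConn y z)ᶜ) ω)) := by
  set D : Set (BondConfig (Fin n)) := (openConn y z)ᶜ with hD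
  set R : ℝ := F univ - F ∅ with hR
  set c : ℝ := F ∅ with hc
  set d : ℝ := ∑ ω, wt⟦w⟧ ω * ind D ω with hd
  set EφF := ∑ ω, wt⟦w⟧ ω * (φ (openEdgeCluster ω y) * F (openEdgeCluster ω y) * ind D ω) with hEφF
  set Eφ := ∑ ω, wt⟦w⟧ ω * (φ (openEdgeCluster ω y) * ind D ω) with hEφ
  set EF := ∑ ω, wt⟦w⟧ ω * (F (openEdgeCluster ω y) * ind D ω) with hEF
  -- shifted function `F' = F − F ∅`, with `0 ≤ F' ≤ R` on clusters
  have hF'0 : ∀ ω : Set (Sym2 (Fin n)), 0 ≤ F (openEdgeCluster ω y) - c := fun ω =>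
    sub_nonneg.2 (hF (empty_subset _))
  have hF'R : ∀ ω : Set (Sym2 (Fin n)), F (openEdgeCluster ω y) - c ≤ R := fun ω => by
    simp only [hR, hc]; linarith [hF (subset_univ (openEdgeCluster ω y))]
  have hind1 : ∀ ω : Set (Sym2 (Fin n)), ind D ω ≤ 1 := fun ω => ind_le_one D ω
  have hind0 : ∀ ω : Set (Sym2 (Fin n)), 0 ≤ ind D ω := fun ω => ind_nonneg D ω
  have hd0 : 0 ≤ d := Finset.sum_nonneg fun ω _ => mul_nonneg (tel_weight_nonneg w ω) (hind0 ω)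
  have hd1 : d ≤ 1 := tel_avg_le w _ 1 hind1
  -- the shifted sums
  have eφ : ∑ ω, wt⟦w⟧ ω * (φ (openEdgeCluster ω y) * (F (openEdgeCluster ω y) - c) * ind D ω) = EφF - c * Eφ := by
    rw [hEφF, hEφ, Finset.mul_sum, ← Finset.sum_sub_distrib]
    exact Finset.sum_congr rfl fun ω _ => by ring
  have eF : ∑ ω, wt⟦w⟧ ω * ((F (openEdgeCluster ω y) - c) * ind D ω) = EF - c * d := by
    rw [hEF, hd, Finset.mul_sum, ← Finset.sum_sub_distrib]
    exact Finset.sum_congr rfl fun ω _ => by ring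
  -- bounds for the shifted sums
  have b1 : -(R * d) ≤ ∑ ω, wt⟦w⟧ ω * (φ (openEdgeCluster ω y) * (F (openEdgeCluster ω y) - c) * ind D ω) := by
    have : ∑ ω, wt⟦w⟧ ω * (-(R * ind D ω)) ≤
        ∑ ω, wt⟦w⟧ ω * (φ (openEdgeCluster ω y) * (F (openEdgeCluster ω y) - c) * ind D ω) := by
      refine Finset.sum_le_sum fun ω _ => mul_le_mul_of_nonneg_left ?_ (tel_weight_nonneg w ω)
      have hφ1 : -1 ≤ φ (openEdgeCluster ω y) := (abs_le.1 (hφ _)).1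
      nlinarith [hF'0 ω, hF'R ω, hind0 ω, hind1 ω, mul_nonneg (hF'0 ω) (hind0 ω)]
    have e : ∑ ω, wt⟦w⟧ ω * (-(R * ind D ω)) = -(R * d) := by
      rw [hd, Finset.mul_sum, ← Finset.sum_neg_distrib]
      exact Finset.sum_congr rfl fun ω _ => by ring
    linarith
  have b2 : ∑ ω, wt⟦w⟧ ω * ((F (openEdgeCluster ω y) - c) * ind D ω) ≤ R * d := by
    have : ∑ ω, wt⟦w⟧ ω * ((F (openEdgeCluster ω y) - c) * ind D ω) ≤ ∑ ω, wt⟦w⟧ ω * (R * ind D ω) :=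
      Finset.sum_le_sum fun ω _ => mul_le_mul_of_nonneg_left
        (mul_le_mul_of_nonneg_right (hF'R ω) (hind0 ω)) (tel_weight_nonneg w ω)
    have e : ∑ ω, wt⟦w⟧ ω * (R * ind D ω) = R * d := by rw [hd, Finset.mul_sum]; exact Finset.sum_congr rfl fun ω _ => by ring
    linarith
  have b3 : 0 ≤ ∑ ω, wt⟦w⟧ ω * ((F (openEdgeCluster ω y) - c) * ind D ω) :=
    Finset.sum_nonneg fun ω _ => mul_nonneg (tel_weight_nonneg w ω) (mul_nonneg (hF'0 ω) (hind0 ω))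
  have b4 : |Eφ| ≤ d := by
    rw [hEφ, hd]
    refine (Finset.abs_sum_le_sum_abs _ _).trans (Finset.sum_le_sum fun ω _ => ?_)
    rw [abs_mul, abs_of_nonneg (tel_weight_nonneg w ω), abs_mul, abs_of_nonneg (hind0 ω)]
    exact mul_le_mul_of_nonneg_left (mul_le_of_le_one_left (hind0 ω) (hφ _)) (tel_weight_nonneg w ω)
  have hR0 : 0 ≤ R := sub_nonneg.2 (hF (empty_subset _))
  -- `S(F) = S(F − c)` and the bounds
  rw [eφ] at b1
  rw [eF] at b2 b3
  have key : d * EφF - Eφ * EF = d * (EφF - c * Eφ) - Eφ * (EF - c * d) := by ring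
  rw [key]
  have t1 : -(R * d) * d ≤ d * (EφF - c * Eφ) := by nlinarith
  have t2 : Eφ * (EF - c * d) ≤ d * (R * d) := by
    have := abs_le.1 b4
    nlinarith
  have hdd : d * d ≤ 1 := by nlinarith
  nlinarith [mul_nonneg hR0 hd0]

end

end Summit.CriticalPhenomena.PercolationContinuityZ3.Theorems
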